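import Summits.CriticalPhenomena.PercolationContinuityZ3.Theorems.Transplant.Slab111HubU19T1b
import Summits.CriticalPhenomena.PercolationContinuityZ3.Theorems.Transplant.Slab111HubU19T2b
import Summits.CriticalPhenomena.PercolationContinuityZ3.Theorems.Transplant.Slab111HubU19T3b
import Summits.CriticalPhenomena.PercolationContinuityZ3.Theorems.Transplant.Slab111HubU19T4b
import Summits.CriticalPhenomena.PercolationContinuityZ3.Theorems.Transplant.Slab111HubU19T5b
import Summits.CriticalPhenomena.PercolationContinuityZ3.Theorems.Transplant.Slab111HubU19T6b
import Summits.CriticalPhenomena.PercolationContinuityZ3.Theorems.Transplant.Slab111HubU19T7b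
import Summits.CriticalPhenomena.PercolationContinuityZ3.Theorems.Transplant.Slab111HubU19T8b
import Summits.CriticalPhenomena.PercolationContinuityZ3.Theorems.Transplant.Slab111HubU19T9b
import Summits.CriticalPhenomena.PercolationContinuityZ3.Theorems.Transplant.Slab111HubU19T10b
import Summits.CriticalPhenomena.PercolationContinuityZ3.Theorems.Transplant.Slab111HubU19T11b
import Summits.CriticalPhenomena.PercolationContinuityZ3.Theorems.Transplant.Slab111HubU19T12b
import Summits.CriticalPhenomena.PercolationContinuityZ3.Theorems.Transplant.Slab111HubU19T13b
import Summits.CriticalPhenomena.PercolationContinuityZ3.Theorems.Transplant.Slab111HubU19T14b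
import Summits.CriticalPhenomena.PercolationContinuityZ3.Theorems.Transplant.Slab111HubU19T15b
import Summits.CriticalPhenomena.PercolationContinuityZ3.Theorems.Transplant.Slab111HubU19T16b
import Summits.CriticalPhenomena.PercolationContinuityZ3.Theorems.Transplant.Slab111HubU19T17b
import Summits.CriticalPhenomena.PercolationContinuityZ3.Theorems.Transplant.Slab111HubU19T18b
import HarnessLib

/-!
# The HUB ROUTING of the `(111)`-films, XXI: all dispatcher tables of the unclipped shape, and `linkage_U19` without hypothesis

builds on p205010 (kernel theorem, internal audit signed; external expert review pending) — NOT used in this file.  Lane `prim-bschramm`, seat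
`prim-bschramm-p2` (gen 36; class C1b; memo `HOME/bschramm/P2-LATTICES.md` §131); helper file (`--supports stmt-CriticalPhenomena-4575 --as helper`).
**`u19_tabs`** collects the 324 kernel-checked tables (files `Slab111HubU19T*`); **`linkage_U19'`** = «Slab111HubU19».`linkage_U19` with the
table hypothesis discharged: the node of «HexShadowVRouteData».`ShapedLinkage 3` at every block with `t_R, s_R ≥ 2`, for `k ≥ 51`.
[cite: DuminilCopinSidoraviciusTassion2016, §2.3 (proof of Fact 2: the three disjoint paths γ_u, γ_v, γ_w in B_R(z))]
-/

noncomputable section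

namespace Summit.CriticalPhenomena.PercolationContinuityZ3.Theorems.Transplant

open Literature.Probability.Percolation Literature.Probability.LatticeModels SimpleGraph

namespace Slab111

/-- **ALL TABLES OF THE UNCLIPPED SHAPE.** [folklore] -/
theorem u19_tabs : ∀ q₁ ∈ hex2.tail, ∀ q₂ ∈ hex2.tail, ∃ A C : ℕ, tab3OK inHex2B inHex2B u19Bad u19Filt hex2 q₁ q₂ A C = true := by
  intro q₁ hq₁
  simp only [hex2, List.tail_cons, List.mem_cons, List.not_mem_nil, or_false] at hq₁
  rcases hq₁ with rfl | rfl | rfl | rfl | rfl | rfl | rfl | rfl | rfl | rfl | rfl | rfl | rfl | rfl | rfl | rfl | rfl | rfl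
  · exact u19row_1
  · exact u19row_2
  · exact u19row_3
  · exact u19row_4
  · exact u19row_5
  · exact u19row_6
  · exact u19row_7
  · exact u19row_8
  · exact u19row_9
  · exact u19row_10
  · exact u19row_11
  · exact u19row_12
  · exact u19row_13
  · exact u19row_14
  · exact u19row_15
  · exact u19row_16
  · exact u19row_17
  · exact u19row_18

/-- **THE NODE OF `ShapedLinkage 3` AT EVERY BLOCK WITH `t_R, s_R ≥ 2`** (`k ≥ 51`), tables discharged. [folklore] -/
theorem linkage_U19' {k : ℕ} (hk : 51 ≤ k) (z : Site 2) {tR tD sR sD : ℕ} (htR : 2 ≤ tR) (hsR : 2 ≤ sR) (htD : tR ≤ tD) (hsD : sR ≤ sD) :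
    ∃ W : Set (slab111 k), (∀ x ∈ W, (hexShadow k).sh x ∈ blkR 3 z tD sD) ∧
      (∀ x, (hexShadow k).sh x ∈ hexBall z 1 → (hexShadow k).sh x ∈ blkR 3 z tD sD → x ∈ W) ∧
      ∀ (E₁ E₂ w' : slab111 k), (hexShadow k).Terminals 3 z tR tD sR W E₁ E₂ w' →
        ∃ r₁ r₂ : VRouteData (film k) (W ∩ (hexShadow k).lift (blkR 3 z tR sR)) W E₁ E₂ w', r₁.y = r₂.b ∧ r₁.b = r₂.y :=
  linkage_U19 hk u19_tabs z htR hsR htD hsD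

end Slab111

end Summit.CriticalPhenomena.PercolationContinuityZ3.Theorems.Transplant

end
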